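import Summits.CriticalPhenomena.PercolationContinuityZ3.Theorems.Transplant.KNCellsBoxProdZ2ConcScheduleG
import Summits.CriticalPhenomena.PercolationContinuityZ3.Theorems.Transplant.KNCells2AnchorDepth
import Summits.CriticalPhenomena.PercolationContinuityZ3.Theorems.Transplant.BoxProdZ2ConcAssemblyG
import HarnessLib

/-!
# (S1) The REALISED geometry at a chosen edge of the concentric `X □ ℤ²` scheme with the schedule of record `concRadiiGB`: the anchors of
# a chosen edge are `(α, α+1)` or the root's `(0, 0)` (p5-g3's `anchors_of_choice_succ`), the onward targets are never the root cell, hence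
# the levels satisfy `nS β x = nQ α x =: n` and `nQ β (x + du) = n + 1`, and every region the three residues meet is a PRODUCT with an
# explicit radius: cube / corridor / faces / stubs at `E n`, far box / between-box at `F (n+1)`, next target at `F (n+1) - L'`, next cube at
# `E (n+1)` (owner split 15:02:43Z, item (S): handed to (R) p2-g2, (F) p3-g2, (C) p5-g3)

builds on p205010 (kernel theorem, internal audit signed; external expert review pending) — nothing in this file uses p205010.
Lane `prim-bschramm-*`, seat `prim-bschramm-stmt` (gen 5); helper file (`--supports stmt-CriticalPhenomena-4575`).

* §1 planar: `gen0_stepVec_add_stepVec` (two unit steps not cancelling have generation `2`), `PCells.cen_zero`;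
* §2 `Realised α β x` (the three anchor configurations of a chosen edge with the shape of its target cell) and, for
  `S = concSchemeG X C w₀ Λ q δc` (any schedule `Λ`): **`realised_of_choice`** (`choice = some e` ⟹ `Realised aOf₁ aOf₂ (tgt e)`),
  **`tgt_add_stepVec_ne_zero`** (valid history, onward `du` ⟹ `tgt e + du ≠ 0`: the root's column is explored);
* §3 levels: `Realised.nS_eq` (`nS β x = nQ α x`), `Realised.nQ_add_stepVec` (`nQ β (x+du) = nQ α x + 1`), `Realised.nQ_pred` (`nQ (β-1) x = nQ α x`);
* §4 radii of `Λ = concRadiiGB C gap gap' E₀ L'` at a realised configuration: `ρ_real` (corridor profile `≡ E n` — the UNIFORM tube),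
  `rE_real` / `rB_real` (`F (n+1)`), `rM_succ_real` (`F (n+1) - L'`), `rQ_real` (`E n`), `rQ_succ_real` (`E (n+1)`);
* §5 regions as products: `stair_of_const`; **`Hfull_real`, `Face_real`, `Stub_real`** (`B(w₀, E n) ×ˢ` planar corridor / face / stub),
  **`Efar_real`, `Btw_real`** (`B(w₀, F (n+1)) ×ˢ …`), **`M_succ_real`** (`B(w₀, F (n+1) - L') ×ˢ C.M (x+du)`), `Q_real`, `Q_succ_real`.
[cite: KozmaNitzan2024, §4 pp. 25–27 (Q_v, M_v, E_{v,x}, H^j_{v,x}), p. 30 (F^j_{v,x})]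
-/

noncomputable section

open scoped Classical

namespace Summit.CriticalPhenomena.PercolationContinuityZ3.Theorems

namespace Transplant

namespace BoxProdZ2

open Literature.Probability.Percolation Literature.Probability.LatticeModels SimpleGraph GadgetSystem Contour KNCells
open Literature.Probability.Percolation.KozmaNitzan.Cells (sgOf stepVec_apply_fst stepVec_apply_oth)

/-! ## §1 Planar facts -/

/-- **Two unit steps that do not cancel reach generation `2`.** [folklore] -/
theorem gen0_stepVec_add_stepVec {d d' : MDir} (h : stepVec d + stepVec d' ≠ (0 : Site 2)) : gen0 (stepVec d + stepVec d') = 2 := by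
  obtain ⟨i, b⟩ := d
  obtain ⟨i', b'⟩ := d'
  fin_cases i <;> fin_cases i' <;> cases b <;> cases b' <;> simp_all [gen0, stepVec]

/-- The centre of the root cell is the origin. [folklore] -/
theorem PCells.cen_zero (C : PCells) : C.cen 0 = 0 := by
  ext i; simp [PCells.cen_apply]

/-! ## §2 The anchor configurations of a chosen edge -/

/-- **The realised anchor configurations** of a chosen edge with region anchor `α`, stub anchor `β` and target cell `x`: away from the root
`β = α + 1` with `α ≥ 1`; a child of the root examining a grandchild (`α = 0`, `β = 1`, `x` = two non-cancelling unit steps); the root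
examining a child (`α = β = 0`, `x` = one unit step). [this work] -/
def Realised (α β : ℕ) (x : Site 2) : Prop :=
  (β = α + 1 ∧ 1 ≤ α) ∨ (α = 0 ∧ β = 1 ∧ x ≠ 0 ∧ ∃ d d' : MDir, x = stepVec d + stepVec d') ∨ (α = 0 ∧ β = 0 ∧ ∃ d : MDir, x = stepVec d)

variable {W : Type} [DecidableEq W] (X : SimpleGraph W) [X.LocallyFinite]
variable (C : PCells) (w₀ : W) (Λ : ConcRadiiG) (q : unitInterval) (δc : ℝ)

/-- The re-centring rule of the concentric geometry is `a ↦ a + 1`. [folklore] -/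
theorem concSchemeG_anchor : ∀ a v P, (concSchemeG X C w₀ Λ q δc).Γ.anchor a v P = a + 1 := fun _ _ _ => rfl

/-- The root anchor of the concentric geometry is `0`. [folklore] -/
theorem concSchemeG_a₀ : (concSchemeG X C w₀ Λ q δc).Γ.a₀ = 0 := rfl

variable {X C w₀ Λ q δc}

/-- **The anchors of a CHOSEN edge are realised** (p5-g3's `anchors_of_choice_succ`, `src_eq_step_of_choice_dep_one`, `tgt_ne_zero_of_choice`).
[folklore] -/
theorem realised_of_choice [Countable W] (h : ProbeHistory (W × Site 2)) {e : Site 2 × MDir}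
    (hc : ((concSchemeG X C w₀ Λ q δc).astOf₂ (X □ zdGraph 2) h).st.choice = some e) :
    Realised ((concSchemeG X C w₀ Λ q δc).aOf₁ (X □ zdGraph 2) h e) ((concSchemeG X C w₀ Λ q δc).aOf₂ (X □ zdGraph 2) h e) (tgt e) := by
  have hanch := concSchemeG_anchor X C w₀ Λ q δc
  have h0 := concSchemeG_a₀ X C w₀ Λ q δc
  have hx : tgt e ≠ 0 := KSchA.tgt_ne_zero_of_choice h hc
  rcases KSchA.anchors_of_choice_succ hanch h0 h hc with hβ | ⟨he1, hα, hβ⟩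
  · by_cases hα : (concSchemeG X C w₀ Λ q δc).aOf₁ (X □ zdGraph 2) h e = 0
    · -- a child of the root examines a grandchild
      have h1 : (concSchemeG X C w₀ Λ q δc).aOf₂ (X □ zdGraph 2) h e = 1 := by rw [hβ, hα]
      obtain ⟨d, hd⟩ := KSchA.src_eq_step_of_choice_dep_one hanch h0 h h1
      refine Or.inr (Or.inl ⟨hα, h1, hx, d, e.2, ?_⟩)
      show e.1 + stepVec e.2 = stepVec d + stepVec e.2
      rw [hd]; show (0 + stepVec d) + stepVec e.2 = stepVec d + stepVec e.2; rw [zero_add]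
    · exact Or.inl ⟨hβ, Nat.one_le_iff_ne_zero.2 hα⟩
  · refine Or.inr (Or.inr ⟨hα, hβ, e.2, ?_⟩)
    show e.1 + stepVec e.2 = stepVec e.2
    rw [he1, zero_add]

/-- **Onward targets are never the root cell**: after a valid history the root is explored, so its column is not onward.
[cite: KozmaNitzan2024, §4 p. 27 ((29))] -/
theorem tgt_add_stepVec_ne_zero [Countable W] {h : ProbeHistory (W × Site 2)} {e : Site 2 × MDir}
    (hV : (concSchemeG X C w₀ Λ q δc).Valid₂ (X □ zdGraph 2) h e) {du : MDir}
    (hdu : du ∈ (concSchemeG X C w₀ Λ q δc).onward (X □ zdGraph 2) h (tgt e)) : tgt e + stepVec du ≠ 0 := by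
  intro h0
  have hroot := hV.root_mem
  have hon := (Finset.mem_filter.1 hdu).2 _ hroot
  apply hon
  show ((w₀, (0 : Site 2)) : W × Site 2).2 = C.cen (tgt e + stepVec du)
  rw [h0, PCells.cen_zero]

/-! ## §3 Levels at a realised configuration -/

namespace Realised

variable {α β : ℕ} {x : Site 2}

/-- `nS β x = nQ α x`: the own-cube level seen from the stub anchor is the cube level at the region anchor. [folklore] -/
theorem nS_eq (hr : Realised α β x) : nS β x = nQ α x := by
  rcases hr with ⟨hβ, hα⟩ | ⟨hα, hβ, hx, d, d', hxd⟩ | ⟨hα, hβ, d, hxd⟩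
  · have hα0 : α ≠ 0 := by omega
    have hβ0 : β ≠ 0 := by omega
    simp only [nS, nQ, hβ0, hα0, if_false]; omega
  · subst hα; subst hβ
    simp only [nS, nQ, one_ne_zero, if_false, if_true]
    rw [hxd] at hx ⊢; rw [gen0_stepVec_add_stepVec hx]
  · subst hα; subst hβ
    have hx : x ≠ 0 := by rw [hxd]; intro h0; have := gen0_stepVec d; rw [h0] at this; simp [gen0] at this
    simp only [nS, nQ, if_true, hx, if_false]
    rw [hxd, gen0_stepVec]

/-- `nQ (β - 1) x = nQ α x`. [folklore] -/
theorem nQ_pred (hr : Realised α β x) : nQ (β - 1) x = nQ α x := by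
  rcases hr with ⟨hβ, _⟩ | ⟨hα, hβ, -⟩ | ⟨hα, hβ, -⟩
  · rw [hβ]; rfl
  · subst hα; subst hβ; rfl
  · subst hα; subst hβ; rfl

/-- `nQ β (x + du) = nQ α x + 1` for an onward direction (target cell `≠ 0`). [folklore] -/
theorem nQ_add_stepVec (hr : Realised α β x) {du : MDir} (hy : x + stepVec du ≠ 0) : nQ β (x + stepVec du) = nQ α x + 1 := by
  rcases hr with ⟨hβ, hα⟩ | ⟨hα, hβ, hx, d, d', hxd⟩ | ⟨hα, hβ, d, hxd⟩
  · have hα0 : α ≠ 0 := by omega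
    have hβ0 : β ≠ 0 := by omega
    simp only [nQ, hβ0, hα0, if_false]; omega
  · subst hα; subst hβ
    simp only [nQ, one_ne_zero, if_false, if_true]
    rw [hxd] at hx; rw [hxd, gen0_stepVec_add_stepVec hx]
  · subst hα; subst hβ
    simp only [nQ, if_true]
    rw [hxd] at hy ⊢; rw [gen0_stepVec_add_stepVec hy, gen0_stepVec]

/-- Hence `nS β x ≤ nQ β (x + du)` and `nS β x ≤ nQ (β - 1) x` (the hypotheses of `concRadiiGB_ρ_eq`) and
`nQ β (x + du) = nS β x + 1` (the hypothesis of `concRadiiGB_rE_eq`). [folklore] -/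
theorem sched_hyps (hr : Realised α β x) {du : MDir} (hy : x + stepVec du ≠ 0) :
    nS β x ≤ nQ β (x + stepVec du) ∧ nS β x ≤ nQ (β - 1) x ∧ nQ β (x + stepVec du) = nS β x + 1 := by
  rw [hr.nS_eq, hr.nQ_pred, hr.nQ_add_stepVec hy]; omega

end Realised

/-! ## §4 The radii of `concRadiiGB` at a realised configuration -/

section Radii

variable (C) (gap gap' : ℕ → ℕ) (E₀ L' : ℕ) {α β : ℕ} {x : Site 2} {du : MDir}

/-- **Uniform tube**: the corridor profile at a realised configuration is the cube radius `E (nQ α x)` on every row. [this work] -/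
theorem ρ_real (hr : Realised α β x) (hy : x + stepVec du ≠ 0) (ℓ : ℤ) :
    (concRadiiGB C gap gap' E₀ L').ρ β x du ℓ = Erad gap gap' E₀ (nQ α x) := by
  obtain ⟨h1, h2, -⟩ := hr.sched_hyps hy
  rw [concRadiiGB_ρ_eq C gap gap' E₀ L' h1 h2 ℓ, hr.nS_eq]

/-- Far-box radius `F (nQ α x + 1)`. [this work] -/
theorem rE_real (hr : Realised α β x) (hy : x + stepVec du ≠ 0) :
    (concRadiiGB C gap gap' E₀ L').rE β x du = Frad gap gap' E₀ (nQ α x + 1) := by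
  obtain ⟨-, -, h3⟩ := hr.sched_hyps hy
  rw [concRadiiGB_rE_eq C gap gap' E₀ L' h3, hr.nS_eq]

/-- Between-box radius `F (nQ α x + 1)` (thin between-box). [this work] -/
theorem rB_real (hr : Realised α β x) (hy : x + stepVec du ≠ 0) :
    (concRadiiGB C gap gap' E₀ L').rB β x du = Frad gap gap' E₀ (nQ α x + 1) := by
  rw [concRadiiGB_rB, rE_real C gap gap' E₀ L' hr hy]

/-- Next target radius `F (nQ α x + 1) - L'`. [this work] -/
theorem rM_succ_real (hr : Realised α β x) (hy : x + stepVec du ≠ 0) :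
    (concRadiiGB C gap gap' E₀ L').rM β (x + stepVec du) = Frad gap gap' E₀ (nQ α x + 1) - L' := by
  rw [concRadiiGB_rM, hr.nQ_add_stepVec hy]

omit [DecidableEq W] in
/-- Cube radius `E (nQ α x)`. [folklore] -/
theorem rQ_real : (concRadiiGB C gap gap' E₀ L').rQ α x = Erad gap gap' E₀ (nQ α x) := rfl

/-- Next cube radius `E (nQ α x + 1)`. [this work] -/
theorem rQ_succ_real (hr : Realised α β x) (hy : x + stepVec du ≠ 0) :
    (concRadiiGB C gap gap' E₀ L').rQ β (x + stepVec du) = Erad gap gap' E₀ (nQ α x + 1) := by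
  rw [concRadiiGB_rQ, hr.nQ_add_stepVec hy]

end Radii

/-! ## §5 The regions as products -/

/-- A staircase with constant profile on its planar set is a product. [folklore] -/
theorem stair_of_const {w₀ : W} {ρ : Site 2 → ℕ} {P : Finset (Site 2)} {R : ℕ} (h : ∀ t ∈ P, ρ t = R) :
    stair X w₀ ρ P = ballFin X w₀ R ×ˢ P := by
  ext y
  rw [mem_stair, Finset.mem_product]
  constructor
  · rintro ⟨h2, h1⟩; exact ⟨h y.2 h2 ▸ h1, h2⟩
  · rintro ⟨h1, h2⟩; exact ⟨h2, h y.2 h2 ▸ h1⟩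

section Regions

variable (X C w₀) (gap gap' : ℕ → ℕ) (E₀ L' : ℕ) (q δc) {α β : ℕ} {x : Site 2} {du : MDir}

/-- **The corridor is the uniform tube** `B(w₀, E n) ×ˢ C.Hfull x du`. [this work] -/
theorem Hfull_real (hr : Realised α β x) (hy : x + stepVec du ≠ 0) :
    (faceDataCG X C w₀ (concRadiiGB C gap gap' E₀ L')).Hfull β x du = ballFin X w₀ (Erad gap gap' E₀ (nQ α x)) ×ˢ C.Hfull x du :=
  stair_of_const fun _ _ => ρ_real C gap gap' E₀ L' hr hy _

/-- **The faces** `F^j = B(w₀, E n) ×ˢ C.Face x du j`. [this work] -/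
theorem Face_real (hr : Realised α β x) (hy : x + stepVec du ≠ 0) (j : ℕ) :
    (faceDataCG X C w₀ (concRadiiGB C gap gap' E₀ L')).Face β x du j = ballFin X w₀ (Erad gap gap' E₀ (nQ α x)) ×ˢ C.Face x du j :=
  stair_of_const fun _ _ => ρ_real C gap gap' E₀ L' hr hy _

/-- **The stubs** `H^j = B(w₀, E n) ×ˢ C.Stub x du j`. [this work] -/
theorem Stub_real (hr : Realised α β x) (hy : x + stepVec du ≠ 0) (j : ℕ) :
    (concSchemeG X C w₀ (concRadiiGB C gap gap' E₀ L') q δc).Γ.Stub β x du j =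
      ballFin X w₀ (Erad gap gap' E₀ (nQ α x)) ×ˢ C.Stub x du j :=
  stair_of_const fun _ _ => ρ_real C gap gap' E₀ L' hr hy _

/-- **The far box** `E^far = B(w₀, F (n+1)) ×ˢ C.Efar x du`. [this work] -/
theorem Efar_real (hr : Realised α β x) (hy : x + stepVec du ≠ 0) :
    (concSchemeG X C w₀ (concRadiiGB C gap gap' E₀ L') q δc).Γ.Efar β x du =
      ballFin X w₀ (Frad gap gap' E₀ (nQ α x + 1)) ×ˢ C.Efar x du := by
  show ballFin X w₀ ((concRadiiGB C gap gap' E₀ L').rE β x du) ×ˢ C.Efar x du = _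
  rw [rE_real C gap gap' E₀ L' hr hy]

/-- **The between-box** `Btw = B(w₀, F (n+1)) ×ˢ C.Btw x du` (thin). [this work] -/
theorem Btw_real (hr : Realised α β x) (hy : x + stepVec du ≠ 0) :
    (concSchemeG X C w₀ (concRadiiGB C gap gap' E₀ L') q δc).Γ.Btw β x du =
      ballFin X w₀ (Frad gap gap' E₀ (nQ α x + 1)) ×ˢ C.Btw x du := by
  show ballFin X w₀ ((concRadiiGB C gap gap' E₀ L').rB β x du) ×ˢ C.Btw x du = _
  rw [rB_real C gap gap' E₀ L' hr hy]

/-- **The next target** `M_β(x+du) = B(w₀, F (n+1) - L') ×ˢ C.M (x+du)`. [this work] -/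
theorem M_succ_real (hr : Realised α β x) (hy : x + stepVec du ≠ 0) :
    (concSchemeG X C w₀ (concRadiiGB C gap gap' E₀ L') q δc).Γ.M β (x + stepVec du) =
      ballFin X w₀ (Frad gap gap' E₀ (nQ α x + 1) - L') ×ˢ C.M (x + stepVec du) := by
  show ballFin X w₀ ((concRadiiGB C gap gap' E₀ L').rM β (x + stepVec du)) ×ˢ C.M (x + stepVec du) = _
  rw [rM_succ_real C gap gap' E₀ L' hr hy]

/-- **The cube** `Q_α(x) = B(w₀, E n) ×ˢ C.Q x`. [folklore] -/
theorem Q_real : (concSchemeG X C w₀ (concRadiiGB C gap gap' E₀ L') q δc).Γ.Q α x = ballFin X w₀ (Erad gap gap' E₀ (nQ α x)) ×ˢ C.Q x :=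
  rfl

/-- **The next cube** `Q_β(x+du) = B(w₀, E (n+1)) ×ˢ C.Q (x+du)`. [this work] -/
theorem Q_succ_real (hr : Realised α β x) (hy : x + stepVec du ≠ 0) :
    (concSchemeG X C w₀ (concRadiiGB C gap gap' E₀ L') q δc).Γ.Q β (x + stepVec du) =
      ballFin X w₀ (Erad gap gap' E₀ (nQ α x + 1)) ×ˢ C.Q (x + stepVec du) := by
  show ballFin X w₀ ((concRadiiGB C gap gap' E₀ L').rQ β (x + stepVec du)) ×ˢ C.Q (x + stepVec du) = _
  rw [rQ_succ_real C gap gap' E₀ L' hr hy]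

end Regions

end BoxProdZ2

end Transplant

end Summit.CriticalPhenomena.PercolationContinuityZ3.Theorems

end
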